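import Literature.AlgebraicGeometry.Motives.TrivialLocusFieldDescent
import Literature.AlgebraicGeometry.Motives.AbelianVarietyWeilPairingBaseChange
import Literature.AlgebraicGeometry.Motives.SeesawTrivialOnRationalSlices
import Literature.AlgebraicGeometry.AbelianVarieties.PoincareSheafFibrewisePicZero
import HarnessLib

/-!
# `Pic(A) → Pic(A_σ)` is injective; homogeneity of a line bundle DESCENDS along every field map `σ : k → L`,
# and ASCENDS along `σ` when `k` is algebraically closed (Mumford §8 (i)⇔(iv))

Layer `Literature/AlgebraicGeometry/AbelianVarieties`, namespace `Literature.AlgebraicGeometry.AbelianVarieties`.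
Cell `hodgecm-mathlib`, road M13 N0 (0d-h) (B-typ03 (g12) lineage; consumer ★ `AbelianVarieties/RigidifiedLineBundleFibrewisePicZeroOfDense`).
HC_CM is proved only modulo the 7 printed citations until rung 0 closes.
THEOREMS ONLY (no definition, no named fact, no instance, no `sorry`).

For an abelian variety `A` over a field `k`, a homomorphism of fields `σ : k → L`, the base change
`A_σ = A.baseChangeAlong σ` (★ `Motives/AbelianVarietyConjugate`) and its projection `π : A_σ → A`
(`π = baseChangeHomFst σ A.X`, passed as a variable `π` with its defining equation `hπ`, the design of ★
`Motives/AbelianVarietyWeilPairingBaseChange`):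

* §1 `cechPic_pullback_baseChangeAlongFst_injective` — **`π^* : Ȟ¹(A, 𝒪^×) → Ȟ¹(A_σ, 𝒪^×)` is injective**
  (`Pic(X) → Pic(X_L)` is injective for `X` proper and geometrically integral over `k`: a divisor class which
  dies on `A_σ` dies on `A`, ★ `CartierDivisor.linEquiv_zero_of_classPullback_whiskerLeft_fieldExt`
  (Görtz–Wedhorn II, Lemma 24.65 / Thm. 24.66 (1): `H⁰(X_L, 𝓛_L) = H⁰(X, 𝓛) ⊗_k L`, and a line bundle with
  `H⁰(𝓛) ≠ 0 ≠ H⁰(𝓛⁻¹)` on a proper integral scheme is trivial), moved from the engine's `A ⊗ Spec L` /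
  `A ⊗ Spec k` to `A_σ` / `A` (the same schemes: Mathlib `Over.tensorObj_left`, ★ `baseChangeHom_obj_left`,
  and the section `(1, str) : A → A ⊗ Spec k` of the first projection);
* §2 **`IsHomogeneous.of_pullback_baseChangeAlongFst`** — for a rank-one module `E` on `A`: if `π^* E` is
  homogeneous on `A_σ` (`t_{P}^* π^*E ≅ π^*E` for all `P ∈ A_σ(L)`), then `E` is homogeneous on `A`
  (`t_{P₀}^* E ≅ E` for all `P₀ ∈ A(k)`): every `P₀` lifts to the point `P = (Spec σ ≫ P₀, id)` of `A_σ(L)` with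
  `t_P ≫ π = π ≫ t_{P₀}` (★ `translation_left_comp_baseChangeAlongFst`), so `π^*(t_{P₀}^*[E]) = t_P^*[π^*E] = [π^*E]
  = π^*[E]` in `Ȟ¹(A_σ, 𝒪^×)` (★ `detClass_pullback`, ★ `CechPic.pullback_comp`), and §1 gives `t_{P₀}^*[E] = [E]`,
  which for rank one is `t_{P₀}^*E ≅ E` (★ `isHomogeneous_iff_forall_pullback_detClass_eq`).
  No algebraic closedness is needed for this direction; the case of record is `k = Ω ⊆ L = Ω'` both
  algebraically closed ([MumfordAV1970] §8: `Pic⁰` «is defined by a geometric condition»).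

* §3 `mk_mumfordCocycle_eq_one_of_forall_linEquiv` — [MumfordAV1970] §8 (i)⇒(iv) over `k = k̄`: if `t_P^*Θ ∼ Θ` for every
  rational point `P` (`K(Θ) = A(k)`), then Mumford's class `[Λ(𝒪(Θ))] = m^*[Θ]·(p₁^*[Θ])⁻¹·(p₂^*[Θ])⁻¹` is TRIVIAL on `A × A`:
  its slice at a rational point `t₀` is `t_{t₀}^*[Θ]·[Θ]⁻¹ = 1` (★ `pullback_mk_mumfordCocycle_of_snd_eq_const`), its slice
  `{0} × A` is trivial (★ `pullback_mk_mumfordCocycle_of_fst_eq_one`), so the seesaw theorem on rational slices over an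
  algebraically closed field (★ `CartierDivisor.linEquiv_zero_of_forall_slice_of_rigidified`, [MumfordAV1970] §5 Cor. 6) applies;
* §4 **`IsHomogeneous.pullback_baseChangeAlongFst`** — the ASCENT: for `k` algebraically closed and `E` homogeneous of rank one
  on `A`, `π^*E` is homogeneous on `A_σ` (`L` arbitrary): `E ≅ 𝒪(Θ)` with `K(Θ) = A(k)`, so `[Λ(𝒪(Θ))] = 1` (§3), and the slice
  of `Λ` at an `L`-VALUED point `a` of `A` is `t_a^*(π^*[Θ])·(π^*[Θ])⁻¹` (★ `cechPic_pullback_slice_mk_mumfordCocycle`,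
  [MumfordAV1970] §8 «`Λ(L)|_{X × {a}} ≅ T_a^*L ⊗ L⁻¹`»), whence `t_a^*(π^*[Θ]) = π^*[Θ]` for every `a ∈ A_σ(L)`.
  (False without `IsAlgClosed k`: translation invariance on `k`-points alone is weaker than `Pic⁰`.)
* §5 the closed forms `isHomogeneous_descent_along`, `isHomogeneous_ascent_along` (the inputs of ★
  `AbelianSchemes/RigidifiedLineBundlePicZeroLocus.fieldChangeInvariant_of_ascent_descent`).

## References
* [GortzWedhorn2023] U. Görtz, T. Wedhorn, *Algebraic Geometry II*, Lemma 24.65 (p. 405), Thm. 24.66 (1) (p. 405),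
  Cor. 22.91 (p. 388).
* [MumfordAV1970] D. Mumford, *Abelian Varieties* (1970), §5 Cor. 6 (seesaw), §8 pp. 74–80 (definition of `Pic⁰`, (i)⇔(iv),
  `Λ(L)|_{X×{a}} ≅ T_a^*L ⊗ L⁻¹`).
* [Mukai1978] S. Mukai, *Semi-homogeneous vector bundles on an abelian variety* (1978), Def. 4.4 (p. 253).
* [Hartshorne1977] R. Hartshorne, *Algebraic Geometry* (1977), II Ex. 6.8 (functoriality of `f^*` on `Pic`).
-/

noncomputable section

open CategoryTheory CategoryTheory.Limits AlgebraicGeometry MonoidalCategory CartesianMonoidalCategory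
open scoped MonObj

universe u

namespace Literature.AlgebraicGeometry.AbelianVarieties

open Literature.AlgebraicGeometry.Motives Literature.AlgebraicGeometry.Modules

variable {k L : Type u} [Field k] [Field L] (σ : k →+* L) (A : AbelianVariety k)
  (π : (A.baseChangeAlong σ).X.left ⟶ A.X.left) (hπ : π = baseChangeHomFst σ A.X)

/-! ### §1 `Pic(A) → Pic(A_σ)` is injective -/

/-- plumbing: the field point `Spec L → Spec k` of `Spec k` defined by `σ`, as a morphism of `k`-schemes
`Spec L ⟶ Spec k` over `Spec k` (target = the monoidal unit `Over.mk (𝟙 (Spec k))`). [cite: Hartshorne1977, II Ex. 2.7] -/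
private theorem specHom_w :
    Spec.map (CommRingCat.ofHom σ) ≫ 𝟙 (Spec (.of k)) = Spec.map (CommRingCat.ofHom σ) :=
  Category.comp_id _

include hπ in
/-- **A divisor class on `A` which dies on `A_σ` dies on `A`** (divisor form of the injectivity of
`Pic(A) → Pic(A_σ)`; Görtz–Wedhorn II, Lemma 24.65 / Thm. 24.66 (1), through ★
`CartierDivisor.linEquiv_zero_of_classPullback_whiskerLeft_fieldExt` for the field points `id` and `Spec σ` of
`Spec k`). [cite: GortzWedhorn2023, Lemma 24.65 (p. 405) and Thm. 24.66 (1) (p. 405)] -/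
theorem linEquiv_zero_of_classPullback_baseChangeAlongFst (D : CartierDivisor A.X.left)
    (h : (D.classPullback π).LinEquiv 0) : D.LinEquiv 0 := by
  -- the two field points of `Spec k`: the identity (unit object) and `Spec σ`
  let U : SchemeOver k := Over.mk (𝟙 (Spec (.of k)))
  let V : SchemeOver k := Over.mk (Spec.map (CommRingCat.ofHom σ))
  let m : V ⟶ U := Over.homMk (Spec.map (CommRingCat.ofHom σ)) (specHom_w σ)
  haveI : IsIntegral U.left := inferInstanceAs (IsIntegral (Spec (.of k)))
  haveI : IsLocallyNoetherian U.left := inferInstanceAs (IsLocallyNoetherian (Spec (.of k)))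
  haveI : IsIntegral V.left := inferInstanceAs (IsIntegral (Spec (.of L)))
  haveI : IsLocallyNoetherian V.left := inferInstanceAs (IsLocallyNoetherian (Spec (.of L)))
  -- the first projection `p : A ⊗ Spec k → A` and its section `s = (1, str)`
  let p : (A.X ⊗ U).left ⟶ A.X.left := pullback.fst A.X.hom (𝟙 _)
  let s : A.X.left ⟶ (A.X ⊗ U).left :=
    pullback.lift (𝟙 _) A.X.hom (by rw [Category.id_comp]; exact (Category.comp_id _).symm)
  have hs : s ≫ p = 𝟙 _ := pullback.lift_fst _ _ _
  -- `(A ◁ m) ≫ p = π` (both are the first projection `A ×_k Spec L → A`)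
  have hmp : (A.X ◁ m).left ≫ p = π := by
    rw [hπ]
    exact Over.whiskerLeft_left_fst m
  -- the engine's hypothesis: `(A ◁ m)^* (p^* D) ∼ (A ◁ m ≫ p)^* D = π^* D ∼ 0`
  have key : ((D.classPullback p).classPullback (A.X ◁ m).left).LinEquiv 0 := by
    refine (CartierDivisor.classPullback_comp_linEquiv p (A.X ◁ m).left D).symm.trans ?_
    rw [CartierDivisor.classPullback_congr hmp D]
    exact h
  have hF : (D.classPullback p).LinEquiv 0 :=
    CartierDivisor.linEquiv_zero_of_classPullback_whiskerLeft_fieldExt A.X m (D.classPullback p) key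
  -- come back along the section: `D ∼ (s ≫ p)^* D ∼ s^*(p^* D) ∼ s^* 0 ∼ 0`
  have h1 : D.LinEquiv ((D.classPullback p).classPullback s) := by
    refine ((D.classPullback_id_linEquiv).symm.trans ?_).trans
      (CartierDivisor.classPullback_comp_linEquiv p s D)
    rw [CartierDivisor.classPullback_congr hs D]
    exact CartierDivisor.LinEquiv.refl _
  have h0 : ((0 : CartierDivisor (A.X ⊗ U).left).classPullback s).LinEquiv 0 := by
    refine (((CartierDivisor.zero_smul_sameDivisor (D.classPullback p)).linEquiv.symm).classPullback s).trans ?_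
    exact ((CartierDivisor.classPullback_smul_linEquiv s (D.classPullback p) 0).trans
      (CartierDivisor.zero_smul_sameDivisor _).linEquiv)
  exact h1.trans ((hF.classPullback s).trans h0)

include hπ in
/-- **`Pic(A) → Pic(A_σ)` is injective**: the pull-back `π^* : Ȟ¹(A, 𝒪_A^×) → Ȟ¹(A_σ, 𝒪_{A_σ}^×)` along the
projection `A_σ = A ×_{k,σ} L → A` is injective (Görtz–Wedhorn II, Thm. 24.66 (1): triviality of a line bundle on a
proper geometrically integral `k`-scheme descends along field extensions; every class on the integral scheme `A` is a
divisor class, ★ `UnitCocycle.cechClass_toCartierDivisor`). [cite: GortzWedhorn2023, Lemma 24.65 (p. 405) and Thm. 24.66 (1) (p. 405)]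
[cite: Hartshorne1977, II Ex. 6.8] -/
theorem cechPic_pullback_baseChangeAlongFst_injective : Function.Injective (CechPic.pullback π) := by
  haveI : IsDominant π := by
    rw [hπ]
    exact AbelianVariety.isDominant_baseChangeHomFst_along σ A
  refine (injective_iff_map_eq_one (CechPic.pullback π)).2 fun x hx => ?_
  obtain ⟨c, rfl⟩ := CechPic.mk_surjective x
  rw [← UnitCocycle.cechClass_toCartierDivisor] at hx ⊢
  rw [← CartierDivisor.cechClass_pullback, ← CartierDivisor.cechClass_zero,
    CartierDivisor.cechClass_eq_iff_linEquiv] at hx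
  rw [← CartierDivisor.cechClass_zero, CartierDivisor.cechClass_eq_iff_linEquiv]
  exact linEquiv_zero_of_classPullback_baseChangeAlongFst σ A π hπ _
    ((CartierDivisor.classPullback_linEquiv_pullback π _).trans hx)

/-! ### §2 Homogeneity descends along `π : A_σ → A` -/

/-- `f^*(g^*x) = (f ≫ g)^*x` on `Ȟ¹(·, 𝒪^×)` (★ `CechPic.pullback_comp` of `Modules/UnitCocyclePresented`, re-derived
privately from `detClass_pullback` to keep the import cone small, as in ★ `PoincareSheafFibrewisePicZero`).
[cite: Hartshorne1977, II Ex. 6.8 (a)] -/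
private theorem cechPic_pullback_pullback {X Y Z : Scheme.{u}} (f : X ⟶ Y) (g : Y ⟶ Z) (x : CechPic Z) :
    CechPic.pullback f (CechPic.pullback g x) = CechPic.pullback (f ≫ g) x := by
  obtain ⟨c, rfl⟩ := CechPic.mk_surjective x
  have hE := c.isFiniteLocallyFree_lineBundle
  rw [← c.detClass_lineBundle, ← detClass_pullback, ← detClass_pullback, ← detClass_pullback]
  exact (detClass_eq_of_iso ((Scheme.Modules.pullbackComp f g).app (lineBundle c)).symm _ _).symm

/-- plumbing: the point `(Spec σ ≫ P₀) ∈ A(L)_σ` of `A` along `σ` defined by a rational point `P₀ ∈ A(k)`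
(Milne 2005 §11: «a point `P ∈ A(k)` gives a point `σP ∈ σA(Ω)`»). [cite: Milne2005ShimuraVarieties, §11 p. 108 («σP ∈ σA(Ω)»)] -/
private theorem pointAlong_w (P₀ : A.Points k) :
    (Spec.map (CommRingCat.ofHom σ) ≫ P₀.left) ≫ A.X.hom =
      Spec.map (CommRingCat.ofHom (algebraMap k (AlongHom L σ))) := by
  have w : P₀.left ≫ A.X.hom = Spec.map (CommRingCat.ofHom (algebraMap k k)) := Over.w P₀
  refine (Category.assoc _ _ _).trans ?_
  refine (congrArg (fun t => Spec.map (CommRingCat.ofHom σ) ≫ t) w).trans ?_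
  rw [Algebra.algebraMap_self, CommRingCat.ofHom_id, Spec.map_id, Category.comp_id]
  rfl

include hπ in
/-- **Every rational point `P₀ ∈ A(k)` lifts to a point `P ∈ A_σ(L)` whose translation covers `t_{P₀}`**:
`t_P ≫ π = π ≫ t_{P₀}` (★ `translation_left_comp_baseChangeAlongFst` for `P = (Spec σ ≫ P₀, id)`).
[cite: GortzWedhorn2023, Def. 27.1 (p. 604)] [cite: Milne2005ShimuraVarieties, §11 p. 108 («σP ∈ σA(Ω)»)] -/
theorem exists_translation_left_comp_baseChangeAlongFst (P₀ : A.Points k) :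
    ∃ P : (A.baseChangeAlong σ).Points L,
      ((A.baseChangeAlong σ).translation P).left ≫ π = π ≫ (A.translation P₀).left := by
  let s : A.Points (AlongHom L σ) := AlgPoints.mk (Spec.map (CommRingCat.ofHom σ) ≫ P₀.left) (pointAlong_w σ A P₀)
  refine ⟨A.pointsAlong σ s, AbelianVariety.translation_left_comp_baseChangeAlongFst σ A π hπ _ P₀ ?_⟩
  rw [hπ, AbelianVariety.pointsAlong_left_comp_fst]
  rfl

include hπ in
/-- **Homogeneity of a line bundle descends along a field map.** For a rank-one module `E` on the abelian variety
`A / k` and `σ : k → L`: if `π^*E` is homogeneous on `A_σ` (`t_P^* π^*E ≅ π^*E` for all `P ∈ A_σ(L)`), then `E` is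
homogeneous on `A` (`t_{P₀}^*E ≅ E` for all `P₀ ∈ A(k)`).  Rank one: `t^*E ≅ E ⟺ t^*[E] = [E]` in `Ȟ¹(𝒪^×)` (★
`isHomogeneous_iff_forall_pullback_detClass_eq`); `π^*(t_{P₀}^*[E]) = t_P^*(π^*[E]) = π^*[E]` for a lift `P` of `P₀`
(`exists_translation_left_comp_baseChangeAlongFst`); conclude by the injectivity of `π^*` (§1).  The case of record:
`k = Ω ⊆ L = Ω'` algebraically closed — `Pic⁰`-membership at a geometric point does not depend on the
algebraically closed field through which the point is taken. [cite: MumfordAV1970, §8 (definition of Pic⁰, (i)⇔(iv))]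
[cite: GortzWedhorn2023, Thm. 24.66 (1) (p. 405)] [cite: Mukai1978, Def. 4.4 (p. 253)] -/
theorem IsHomogeneous.of_pullback_baseChangeAlongFst {E : A.X.left.Modules} (h₁ : HasRank E 1)
    (h : IsHomogeneous (A.baseChangeAlong σ) ((Scheme.Modules.pullback π).obj E)) : IsHomogeneous A E := by
  have hE : IsFiniteLocallyFree E := Literature.AlgebraicGeometry.Modules.HasRank.isFiniteLocallyFree' h₁
  have h₁' : HasRank ((Scheme.Modules.pullback π).obj E) 1 := hasRank_pullback π h₁
  rw [isHomogeneous_iff_forall_pullback_detClass_eq _ h₁' (hE.pullback π)] at h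
  rw [isHomogeneous_iff_forall_pullback_detClass_eq _ h₁ hE]
  intro P₀
  obtain ⟨P, hP⟩ := exists_translation_left_comp_baseChangeAlongFst σ A π hπ P₀
  apply cechPic_pullback_baseChangeAlongFst_injective σ A π hπ
  have hP' := h P
  rw [detClass_pullback π hE, cechPic_pullback_pullback, hP, ← cechPic_pullback_pullback] at hP'
  exact hP'

/-- The same with the projection spelled `baseChangeHomFst σ A.X` (`Ω ⊆ Ω'` algebraically closed is the special case
`k = Ω`, `L = Ω'`, `σ` the inclusion). [cite: MumfordAV1970, §8 (definition of Pic⁰, (i)⇔(iv))] -/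
theorem IsHomogeneous.of_baseChangeAlong {E : A.X.left.Modules} (h₁ : HasRank E 1)
    (h : IsHomogeneous (A.baseChangeAlong σ) ((Scheme.Modules.pullback (baseChangeHomFst σ A.X)).obj E)) :
    IsHomogeneous A E :=
  IsHomogeneous.of_pullback_baseChangeAlongFst σ A (baseChangeHomFst σ A.X) rfl h₁ h

/-! ### §3 [Mumford §8 (i)⇒(iv)] over `k = k̄`: `K(Θ) = A(k)` ⇒ `[Λ(𝒪(Θ))] = 1` on `A × A` -/

section MumfordTrivial

variable {K : Type u} [Field K] [IsAlgClosed K] (B : AbelianVariety K) (Θ : CartierDivisor B.X.left)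

omit [IsAlgClosed K] in
/-- plumbing: the rational slice `X ≅ X × Spec K —X × t₀→ X × X` composed with the second projection is the constant point
`X → Spec K →ᵗ⁰ X`, written through `toSpecOver` as ★ `pullback_mk_mumfordCocycle_of_snd_eq_const` wants it.
[cite: GortzWedhorn2023, Def./Rem. 27.1 (p. 604)] -/
private theorem slice_snd_eq (t₀ : 𝟙_ (SchemeOver K) ⟶ B.X) :
    ((ρ_ B.X).inv ≫ B.X ◁ t₀) ≫ snd B.X B.X = toSpecOver B.X ≫ (toUnit _ ≫ t₀) := by
  rw [Category.assoc, whiskerLeft_snd, ← Category.assoc, rightUnitor_inv_snd, ← Category.assoc, comp_toUnit]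

omit [IsAlgClosed K] in
/-- plumbing: the slice `X ≅ Spec K × X —0 × X→ X × X` composed with the first projection is the unit point `1 : X → X`.
[cite: GortzWedhorn2023, Def./Rem. 27.1 (p. 604)] -/
private theorem sliceZero_fst_eq :
    ((λ_ B.X).inv ≫ (1 : 𝟙_ (SchemeOver K) ⟶ B.X) ▷ B.X) ≫ fst B.X B.X = 1 := by
  rw [Category.assoc, whiskerRight_fst, ← Category.assoc, leftUnitor_inv_fst, MonObj.comp_one]

/-- **[MumfordAV1970] §8 (i)⇒(iv) over an algebraically closed field**: if `t_P^*Θ ∼ Θ` for every rational point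
`P ∈ A(K)` (i.e. `K(Θ) = A(K)`, `𝒪(Θ) ∈ Pic⁰`), then the class of Mumford's cocycle
`[Λ(𝒪(Θ))] = m^*[Θ]·(p₁^*[Θ])⁻¹·(p₂^*[Θ])⁻¹` on `A × A` is trivial.  Proof: the slice of `Λ` at a rational point `t₀` is
`t_{t₀}^*[Θ]·[Θ]⁻¹ = 1` (★ `pullback_mk_mumfordCocycle_of_snd_eq_const`), the slice `{0} × A` is trivial (★
`pullback_mk_mumfordCocycle_of_fst_eq_one`), and a divisor class on `A ×_K A` trivial on all rational slices `A × {t₀}` and on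
`{0} × A` is trivial (seesaw, ★ `CartierDivisor.linEquiv_zero_of_forall_slice_of_rigidified`; `K = K̄`).
[cite: MumfordAV1970, §8 ((i) ⇔ (iv), pp. 74–80) and §5 Cor. 6] -/
theorem mk_mumfordCocycle_eq_one_of_forall_linEquiv
    (hΘ : ∀ P : B.Points K, (Θ.pullback (B.translation P).left).LinEquiv Θ) :
    CechPic.mk (mumfordCocycle B Θ) = 1 := by
  have hD : (mumfordCocycle B Θ).toCartierDivisor.cechClass = CechPic.mk (mumfordCocycle B Θ) :=
    UnitCocycle.cechClass_toCartierDivisor _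
  rw [← hD, ← CartierDivisor.cechClass_zero, CartierDivisor.cechClass_eq_iff_linEquiv]
  refine CartierDivisor.linEquiv_zero_of_forall_slice_of_rigidified B.X B.X _ (fun t₀ => ?_)
    (1 : 𝟙_ (SchemeOver K) ⟶ B.X) ?_
  · -- the slice at the rational point `t₀`: `t_{t₀}^*[Θ]·[Θ]⁻¹ = 1`
    rw [← CartierDivisor.cechClass_eq_iff_linEquiv, CartierDivisor.cechClass_zero,
      ← CartierDivisor.pullback_cechClass_eq_cechClass_classPullback, hD,
      pullback_mk_mumfordCocycle_of_snd_eq_const B Θ _ (toUnit _ ≫ t₀) (slice_snd_eq B t₀),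
      (hΘ _).cechClass_eq, mul_inv_cancel, map_one]
  · -- the rigidification along `{0} × A`
    rw [← CartierDivisor.cechClass_eq_iff_linEquiv, CartierDivisor.cechClass_zero,
      ← CartierDivisor.pullback_cechClass_eq_cechClass_classPullback, hD]
    exact pullback_mk_mumfordCocycle_of_fst_eq_one B Θ _ (sliceZero_fst_eq B)

end MumfordTrivial

/-! ### §4 Homogeneity ASCENDS along `π : A_σ → A` when `k` is algebraically closed -/

include hπ in
/-- **Homogeneity of a line bundle ascends along a field map from an algebraically closed field.** For `k`
algebraically closed, a rank-one module `E` on `A / k`, and `σ : k → L` (any field `L`): if `E` is homogeneous on `A`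
(`t_{P₀}^*E ≅ E` for all `P₀ ∈ A(k)`), then `π^*E` is homogeneous on `A_σ` (`t_P^*π^*E ≅ π^*E` for ALL `P ∈ A_σ(L)`, not only
those coming from `A(k)`).  Proof: `E ≅ 𝒪(Θ)` (★ `exists_iso_lineBundle_toUnitCocycle`) with `t_{P₀}^*Θ ∼ Θ` for all `P₀`, so
`[Λ(𝒪(Θ))] = 1` on `A × A` (§3); for `P = (a, id) ∈ A_σ(L)`, `a ∈ A(L)_σ`, the slice of `Λ` along
`(pr₁, a∘pr₂) : A_σ → A × A` has class `t_P^*(π^*[Θ])·(π^*[Θ])⁻¹` (★ `cechPic_pullback_slice_mk_mumfordCocycle`, [MumfordAV1970]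
§8 «`Λ(L)|_{X×{a}} ≅ T_a^*L ⊗ L⁻¹`» at an `L`-valued point), hence `t_P^*[π^*E] = [π^*E]`, which in rank one is
`t_P^*π^*E ≅ π^*E`. [cite: MumfordAV1970, §8 ((i) ⇔ (iv), pp. 74–80)] [cite: Mukai1978, Def. 4.4 (p. 253)] -/
theorem IsHomogeneous.pullback_baseChangeAlongFst [IsAlgClosed k] {E : A.X.left.Modules} (h₁ : HasRank E 1)
    (h : IsHomogeneous A E) : IsHomogeneous (A.baseChangeAlong σ) ((Scheme.Modules.pullback π).obj E) := by
  have hE : IsFiniteLocallyFree E := Literature.AlgebraicGeometry.Modules.HasRank.isFiniteLocallyFree' h₁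
  obtain ⟨Θ, ⟨φ⟩⟩ := exists_iso_lineBundle_toUnitCocycle h₁
  have hΘ : ∀ P : A.Points k, (Θ.pullback (A.translation P).left).LinEquiv Θ :=
    (isHomogeneous_iff_forall_linEquiv_of_iso A φ).1 h
  have hΛ := mk_mumfordCocycle_eq_one_of_forall_linEquiv A Θ hΘ
  rw [isHomogeneous_iff_forall_pullback_detClass_eq _ (hasRank_pullback π h₁) (hE.pullback π)]
  intro P
  rw [detClass_pullback π hE, detClass_eq_cechClass_of_iso φ hE]
  obtain ⟨a, rfl⟩ := (A.pointsAlong σ).surjective P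
  -- the slice `G = (pr₁, a∘pr₂) : A_σ → A × A`
  obtain ⟨G, hG⟩ : ∃ G : (A.baseChangeAlong σ).X.left ⟶ (A.X ⊗ A.X).left,
      G = (lift (A.fstPt (AlongHom L σ)) (A.constPt (AlongHom L σ) a)).left := ⟨_, rfl⟩
  have hπ' : π = pullback.fst A.X.hom (AbelianVariety.bcSpec k (AlongHom L σ)) := hπ
  have hG₁ : G ≫ (fst A.X A.X).left = π := by
    rw [hG, hπ']
    exact congrArg CommaMorphism.left (lift_fst (A.fstPt (AlongHom L σ)) (A.constPt (AlongHom L σ) a))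
  have hG₂ : G ≫ (snd A.X A.X).left = (A.baseChange (AlongHom L σ)).X.hom ≫ a.left := by
    rw [hG]
    exact congrArg CommaMorphism.left (lift_snd (A.fstPt (AlongHom L σ)) (A.constPt (AlongHom L σ) a))
  have key := cechPic_pullback_slice_mk_mumfordCocycle (AlongHom L σ) A Θ a π hπ' G hG₁ hG₂
  rw [hΛ, map_one] at key
  exact mul_inv_eq_one.1 key.symm

/-! ### §5 Closed forms (`π` spelled `pullback.fst A.X.hom (Spec.map σ)`) -/

/-- **DESCENT with the projection spelled `pullback.fst A.X.hom (Spec.map (CommRingCat.ofHom σ))`** (= `baseChangeHomFst σ A.X`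
by `rfl`). [cite: MumfordAV1970, §8 ((i) ⇔ (iv))] -/
theorem IsHomogeneous.of_pullbackFst {E : A.X.left.Modules} (h₁ : HasRank E 1)
    (h : IsHomogeneous (A.baseChangeAlong σ)
      ((Scheme.Modules.pullback (pullback.fst A.X.hom (Spec.map (CommRingCat.ofHom σ)))).obj E)) :
    IsHomogeneous A E :=
  IsHomogeneous.of_pullback_baseChangeAlongFst σ A (pullback.fst A.X.hom (Spec.map (CommRingCat.ofHom σ))) rfl h₁ h

/-- **ASCENT with the projection spelled `pullback.fst A.X.hom (Spec.map (CommRingCat.ofHom σ))`** (`k` algebraically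
closed). [cite: MumfordAV1970, §8 ((i) ⇔ (iv))] -/
theorem IsHomogeneous.pullbackFst [IsAlgClosed k] {E : A.X.left.Modules} (h₁ : HasRank E 1) (h : IsHomogeneous A E) :
    IsHomogeneous (A.baseChangeAlong σ)
      ((Scheme.Modules.pullback (pullback.fst A.X.hom (Spec.map (CommRingCat.ofHom σ)))).obj E) :=
  IsHomogeneous.pullback_baseChangeAlongFst σ A (pullback.fst A.X.hom (Spec.map (CommRingCat.ofHom σ))) rfl h₁ h

/-- **Descent, closed form**: homogeneity of rank-one modules descends along every map of algebraically closed fields.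
[cite: MumfordAV1970, §8 ((i) ⇔ (iv))] -/
theorem isHomogeneous_descent_along :
    ∀ (Ω₁ : Type u) [Field Ω₁] [IsAlgClosed Ω₁] (Ω₂ : Type u) [Field Ω₂] [IsAlgClosed Ω₂] (ψ : Ω₁ →+* Ω₂)
      (C : AbelianVariety Ω₁) (E : C.X.left.Modules), HasRank E 1 →
        IsHomogeneous (C.baseChangeAlong ψ)
          ((Scheme.Modules.pullback (pullback.fst C.X.hom (Spec.map (CommRingCat.ofHom ψ)))).obj E) →
            IsHomogeneous C E :=
  fun _ _ _ _ _ _ ψ C _ h₁ h => IsHomogeneous.of_pullbackFst ψ C h₁ h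

/-- **Ascent, closed form**: homogeneity of rank-one modules ascends along every map of algebraically closed fields.
[cite: MumfordAV1970, §8 ((i) ⇔ (iv))] -/
theorem isHomogeneous_ascent_along :
    ∀ (Ω₁ : Type u) [Field Ω₁] [IsAlgClosed Ω₁] (Ω₂ : Type u) [Field Ω₂] [IsAlgClosed Ω₂] (ψ : Ω₁ →+* Ω₂)
      (C : AbelianVariety Ω₁) (E : C.X.left.Modules), HasRank E 1 → IsHomogeneous C E →
        IsHomogeneous (C.baseChangeAlong ψ)
          ((Scheme.Modules.pullback (pullback.fst C.X.hom (Spec.map (CommRingCat.ofHom ψ)))).obj E) :=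
  fun _ _ _ _ _ _ ψ C _ h₁ h => IsHomogeneous.pullbackFst ψ C h₁ h

end Literature.AlgebraicGeometry.AbelianVarieties

end
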